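import Summits.ResolutionOfSingularities.ResolutionOfSingularities.Theorems.FrobeniusClosingPatchingRelPerfectDepthTaylorFlagComap
import Summits.ResolutionOfSingularities.ResolutionOfSingularities.Theorems.FrobeniusClosingPatchingRelPerfectDepthBlowupPolynomialChart
import HarnessLib

/-!
# Crux `PatchingRelPerfect` (stmt-ResolutionOfSingularities-16161), chain W5.2 — depth-`ℓ` programme beyond the graded case,
# GLUE G3: the chart PROPAGATION square — the coefficient flag of the controlled transform is the Kawanoue–Matsuki
# transform of the coefficient flag, for abstract retraction charts (lead prover, gen 4)

[OURS · L1 W5.2 · lead] Replaces the role of NO printed item; NOT a statement of the manuscript under review.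

Ring-level model of ONE dictionary step on affine retraction charts. Stage `j`: a retraction pair `φk : R → A`, `φr : A → R`
with principal kernel `(t₀)`, comparison map `ψ = eval₂RingHom φr t₀ : A[t] → R`, residual ideal `K ⊆ R` with `t₀^ℓ ∈ K`.
Base step `f : A → A′` (a chart of `Bl_𝔷 A`, exceptional generator `z′`), X-side step `β : R → R′` (the corresponding chart of the
blow-up of `R` along `φr(𝔷)R + (t₀)`), stage `j+1` pair `φk′, φr′, t₀′` on `R′`, tied by the SQUARE `β ∘ φr = φr′ ∘ f`,
`β t₀ = φr′(z′) · t₀′` (`t = z′ t′`). Then, with `𝔎 := ψ⁻¹K` and the controlled transform `K′ := (K·R′ : φr′(z′)^ℓ)`: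

* `map_comap_eval₂RingHom_eq` — `K = ψ(𝔎)·R` (`K ∋ t₀^ℓ` is determined by its polynomial pull-back);
* `eval₂RingHom_comp_substStep` — the square on polynomials: `ψ′ ∘ substStep f z′ = β ∘ ψ`;
* **`comap_controlledTransform_eq_colon`** — `ψ′⁻¹ K′ = (substStep(𝔎)·A′[t′] : z′^ℓ)`, the POLYNOMIAL controlled transform, provided
  E-side permissibility in divided form `f(coeffIdeal 𝔎 b) ⊆ (z′^{ℓ−b})` (`b < ℓ`) and `z′`, `φr′ z′`, `t₀′` non-zero-divisors;
* **`coeffFlagRing_controlledTransform`** — THE PROPAGATION LAW: for `b < ℓ`,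
  `coeffFlagRing φk′ φr′ b K′ = Σ_{j ≤ b} (f(coeffFlagRing φk φr j K)·A′ : z′^{ℓ−j})`
  (G2′ `coeffFlagRing_eq_coeffIdeal_comap` on both stages + p508112 `coeffIdeal_transform_eq`).

With p512387 `ideal_top_coeffFlag` this is, chart by chart, the propagation of the abstract coefficient flag `coeffFlag` (p507375)
through a weight-`ℓ` dictionary step: `coeffFlag_b(K′) = Σ_{j≤b} τᶜ(coeffFlag_j(K), ℓ−j)` — Kawanoue–Matsuki's transformation rule for the
idealistic filtration, generator-wise (tri-1 TRIAGE v9 A2 «level-mixing transform»). Fact-free; AI-written, weaker than expert review.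
The scheme-level bookkeeping (supplying the chart data from the chain's `step`) is plan-1's F6 typing.

References: H. Kawanoue, K. Matsuki, Adv. Stud. Pure Math. 70 (2016), §2 (transformation of an idealistic filtration) [KawanoueMatsuki2016];
E. Bierstone, D. Grigoriev, P. Milman, J. Włodarczyk, arXiv:1206.3090, §3.2 Lemma 3.2.1 [BierstoneGrigorievMilmanWlodarczyk2011].
-/

-- `Summit.<Summit>.<Sub>.Theorems` with `Sub = Summit` (single-conjunct summit, D-0017)
set_option linter.dupNamespace false

noncomputable section

open Polynomial

namespace Summit.ResolutionOfSingularities.ResolutionOfSingularities.Theorems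

universe u

namespace DepthGraded.Taylor

section Step

variable {R A R' A' : Type u} [CommRing R] [CommRing A] [CommRing R'] [CommRing A']
  (φk : R →+* A) (φr : A →+* R) (t₀ : R) (hkr : ∀ a, φk (φr a) = a) (hker : RingHom.ker φk = Ideal.span {t₀})
  (φk' : R' →+* A') (φr' : A' →+* R') (t₀' : R') (hkr' : ∀ a, φk' (φr' a) = a)
  (hker' : RingHom.ker φk' = Ideal.span {t₀'})
  (f : A →+* A') (z' : A') (β : R →+* R')
  (hc1 : ∀ a, β (φr a) = φr' (f a)) (hc2 : β t₀ = φr' z' * t₀')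

include hkr hker in
/-- **`K = ψ(ψ⁻¹K)·R`** for `K ∋ t₀^ℓ`: a residual ideal containing `t₀^ℓ` is generated by its polynomial pull-back (truncated identity).
[folklore] -/
theorem map_comap_eval₂RingHom_eq {K : Ideal R} {ℓ : ℕ} (hK : t₀ ^ ℓ ∈ K) :
    (K.comap (Polynomial.eval₂RingHom φr t₀)).map (Polynomial.eval₂RingHom φr t₀) = K := by
  refine le_antisymm Ideal.map_comap_le fun k hk => ?_
  obtain ⟨q, u, hkq⟩ := exists_eq_eval₂_add_pow_mul φk φr t₀ hkr hker ℓ k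
  have hXℓ : Polynomial.eval₂RingHom φr t₀ (X ^ ℓ) = t₀ ^ ℓ := by
    rw [map_pow, Polynomial.coe_eval₂RingHom, Polynomial.eval₂_X]
  have hq : q ∈ K.comap (Polynomial.eval₂RingHom φr t₀) := by
    rw [Ideal.mem_comap, eq_sub_of_add_eq hkq.symm]
    exact Submodule.sub_mem _ hk (Ideal.mul_mem_right _ _ hK)
  have hX : (X : A[X]) ^ ℓ ∈ K.comap (Polynomial.eval₂RingHom φr t₀) := by
    rw [Ideal.mem_comap, hXℓ]; exact hK
  rw [hkq, ← hXℓ]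
  exact Submodule.add_mem _ (Ideal.mem_map_of_mem _ hq) (Ideal.mul_mem_right _ _ (Ideal.mem_map_of_mem _ hX))

include hc1 hc2 in
/-- **The square on polynomials**: `ψ′ ∘ substStep f z′ = β ∘ ψ` (`t = z′·t′`, constants through `β ∘ φr = φr′ ∘ f`). [folklore] -/
theorem eval₂RingHom_comp_substStep :
    (Polynomial.eval₂RingHom φr' t₀').comp (substStep f z') = β.comp (Polynomial.eval₂RingHom φr t₀) := by
  refine Polynomial.ringHom_ext (fun a => ?_) ?_
  · rw [RingHom.comp_apply, RingHom.comp_apply, substStep_C, Polynomial.coe_eval₂RingHom, Polynomial.eval₂_C,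
      Polynomial.coe_eval₂RingHom, Polynomial.eval₂_C, hc1]
  · rw [RingHom.comp_apply, RingHom.comp_apply, substStep_X, map_mul, Polynomial.coe_eval₂RingHom, Polynomial.eval₂_C,
      Polynomial.eval₂_X, Polynomial.coe_eval₂RingHom, Polynomial.eval₂_X, hc2]

include hkr' in
/-- **Truncated uniqueness**: if `t₀′` is a non-zero-divisor and `ψ′ x ∈ (t₀′^ℓ)` then the coefficients of `x` of order `< ℓ` vanish,
i.e. `t^ℓ ∣ x` (apply `φk′` and cancel `t₀′`, inductively). [folklore] -/
theorem X_pow_dvd_of_eval₂_mem_span_pow (hkt' : φk' t₀' = 0) (ht₀' : ∀ x : R', t₀' * x = 0 → x = 0) :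
    ∀ (ℓ : ℕ) (x : A'[X]), Polynomial.eval₂RingHom φr' t₀' x ∈ Ideal.span {t₀' ^ ℓ} → X ^ ℓ ∣ x
  | 0, x, _ => by rw [pow_zero]; exact one_dvd x
  | ℓ + 1, x, hx => by
    -- constant coefficient: apply `φk′`
    obtain ⟨w, hw⟩ := Ideal.mem_span_singleton'.mp hx
    have h0 : x.coeff 0 = 0 := by
      have := congrArg φk' hw
      rw [map_mul, map_pow, hkt', zero_pow (Nat.succ_ne_zero ℓ), mul_zero,
        apply_eval₂RingHom_eq_coeff_zero φk' φr' t₀' hkr' hkt'] at this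
      exact this.symm
    -- `x = t · divX x`, and `ψ′(divX x) ∈ (t₀′^ℓ)` after cancelling `t₀′`
    have hx' : x = X * Polynomial.divX x := by
      conv_lhs => rw [← Polynomial.X_mul_divX_add x, h0, map_zero, add_zero]
    have hψx : Polynomial.eval₂RingHom φr' t₀' x = t₀' * Polynomial.eval₂RingHom φr' t₀' (Polynomial.divX x) := by
      conv_lhs => rw [hx']
      rw [map_mul, Polynomial.coe_eval₂RingHom, Polynomial.eval₂_X]
    have hmem : Polynomial.eval₂RingHom φr' t₀' (Polynomial.divX x) ∈ Ideal.span {t₀' ^ ℓ} := by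
      refine Ideal.mem_span_singleton'.mpr ⟨w, (sub_eq_zero.mp (ht₀' _ ?_)).symm⟩
      rw [mul_sub, ← hψx, ← hw]
      ring
    obtain ⟨y, hy⟩ := X_pow_dvd_of_eval₂_mem_span_pow hkt' ht₀' ℓ _ hmem
    refine ⟨y, ?_⟩
    rw [hx', hy, pow_succ', mul_assoc]

variable {ℓ : ℕ} {K : Ideal R} (hK : t₀ ^ ℓ ∈ K)
  (hperm : ∀ b < ℓ, (coeffIdeal (K.comap (Polynomial.eval₂RingHom φr t₀)) b).map f ≤ Ideal.span {z' ^ (ℓ - b)})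
  (hz' : ∀ (m : ℕ) (x : A'), z' ^ m * x = 0 → x = 0) (hzR' : ∀ x : R', φr' z' ^ ℓ * x = 0 → x = 0)
  (ht₀' : ∀ x : R', t₀' * x = 0 → x = 0)

include hperm in
/-- Divided Taylor coefficients on the chart (choice of `c′_b` with `f(coeff_b p) = z′^{ℓ−b} c′_b` for `p ∈ 𝔎`, `b < ℓ`). [folklore] -/
theorem exists_dividedCoeff :
    ∃ c : A[X] → ℕ → A', ∀ p ∈ K.comap (Polynomial.eval₂RingHom φr t₀), ∀ b < ℓ,
      f (p.coeff b) = z' ^ (ℓ - b) * c p b := by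
  have hex : ∀ (p : A[X]) (b : ℕ), ∃ c' : A',
      p ∈ K.comap (Polynomial.eval₂RingHom φr t₀) ∧ b < ℓ → f (p.coeff b) = z' ^ (ℓ - b) * c' := by
    intro p b
    by_cases h : p ∈ K.comap (Polynomial.eval₂RingHom φr t₀) ∧ b < ℓ
    · obtain ⟨c', hc'⟩ := Ideal.mem_span_singleton'.mp
        (hperm b h.2 (Ideal.mem_map_of_mem f (coeff_mem_coeffIdeal h.1 b)))
      exact ⟨c', fun _ => by rw [← hc', mul_comm]⟩
    · exact ⟨0, fun h' => absurd h' h⟩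
  choose c hc using hex
  exact ⟨c, fun p hp b hb => hc p b ⟨hp, hb⟩⟩

include hperm in
/-- Quotients on the chart: `substStep f z′ p = z′^ℓ · q_p` with `coeff_b q_p = c′_b(p)` for `p ∈ 𝔎`. [folklore] -/
theorem exists_quotient :
    ∃ (q : A[X] → A'[X]) (c : A[X] → ℕ → A'),
      (∀ p ∈ K.comap (Polynomial.eval₂RingHom φr t₀), substStep f z' p = Polynomial.C (z' ^ ℓ) * q p) ∧
      (∀ p ∈ K.comap (Polynomial.eval₂RingHom φr t₀), ∀ b < ℓ, (q p).coeff b = c p b) ∧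
      (∀ p ∈ K.comap (Polynomial.eval₂RingHom φr t₀), ∀ b < ℓ, f (p.coeff b) = z' ^ (ℓ - b) * c p b) := by
  obtain ⟨c, hc⟩ := exists_dividedCoeff φr t₀ f z' hperm
  have hex : ∀ p : A[X], ∃ q : A'[X], p ∈ K.comap (Polynomial.eval₂RingHom φr t₀) →
      substStep f z' p = Polynomial.C (z' ^ ℓ) * q ∧ ∀ b < ℓ, q.coeff b = c p b := by
    intro p
    by_cases hp : p ∈ K.comap (Polynomial.eval₂RingHom φr t₀)
    · obtain ⟨q, hq⟩ := exists_eq_C_pow_mul_of_coeff f z' (substStep f z') (coeff_substStep f z') p (c p) (hc p hp)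
      exact ⟨q, fun _ => hq⟩
    · exact ⟨0, fun h => absurd h hp⟩
  choose q hq using hex
  exact ⟨q, c, fun p hp => (hq p hp).1, fun p hp => (hq p hp).2, hc⟩

include hkr hker in
/-- Elements of `ψ(I)·R` decompose as `ψ g + t₀^m u` with `g ∈ I` (truncated identity). [folklore] -/
theorem exists_eq_eval₂_add_pow_mul_of_mem_map_eval₂ (I : Ideal A[X]) (m : ℕ) {w : R}
    (hw : w ∈ I.map (Polynomial.eval₂RingHom φr t₀)) :
    ∃ g ∈ I, ∃ u : R, w = Polynomial.eval₂RingHom φr t₀ g + t₀ ^ m * u := by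
  refine Submodule.span_induction (p := fun w _ => ∃ g ∈ I, ∃ u : R,
      w = Polynomial.eval₂RingHom φr t₀ g + t₀ ^ m * u) ?_ ?_ ?_ ?_ hw
  · rintro _ ⟨g, hg, rfl⟩
    exact ⟨g, hg, 0, by rw [mul_zero, add_zero]⟩
  · exact ⟨0, Submodule.zero_mem _, 0, by rw [map_zero, mul_zero, add_zero]⟩
  · rintro x y - - ⟨g₁, hg₁, u₁, rfl⟩ ⟨g₂, hg₂, u₂, rfl⟩
    exact ⟨g₁ + g₂, Submodule.add_mem _ hg₁ hg₂, u₁ + u₂, by rw [map_add, mul_add]; abel⟩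
  · rintro s w - ⟨g, hg, u, rfl⟩
    obtain ⟨σ, v, hs⟩ := exists_eq_eval₂_add_pow_mul φk φr t₀ hkr hker m s
    refine ⟨σ * g, Ideal.mul_mem_left _ _ hg, v * Polynomial.eval₂RingHom φr t₀ g + s * u, ?_⟩
    rw [smul_eq_mul, hs, map_mul]
    ring

include hc2 hK in
/-- The controlled transform keeps the power of the new generator: `t₀′^ℓ ∈ (K·R′ : φr′(z′)^ℓ)` (`β(t₀^ℓ) = φr′(z′)^ℓ t₀′^ℓ`). [folklore] -/
theorem pow_mem_controlledTransform :
    t₀' ^ ℓ ∈ (K.map β).colon (Ideal.span {φr' z' ^ ℓ} : Set R') := by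
  rw [Ideal.mem_colon_span_singleton, ← mul_pow, mul_comm, ← hc2, ← map_pow]
  exact Ideal.mem_map_of_mem β hK

include hkr hker hkr' hker' hc1 hc2 hK hperm hz' hzR' ht₀' in
/-- [OURS · L1 W5.2 · lead] **GLUE G3 — the pull-back of the controlled transform is the polynomial controlled transform**:
`ψ′⁻¹ ((K·R′ : φr′(z′)^ℓ)) = (substStep(ψ⁻¹K)·A′[t′] : z′^ℓ)`. (`⊇`: the square; `⊆`: `K = ψ(𝔎)R`, cancel `φr′(z′)^ℓ`, then the truncated
uniqueness `ψ′ x ∈ (t₀′^ℓ) ⇒ t^ℓ ∣ x` and `t′^ℓ ∈` the polynomial transform.) [cite: BierstoneGrigorievMilmanWlodarczyk2011, §3.2 Lemma 3.2.1] -/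
theorem comap_controlledTransform_eq_colon :
    ((K.map β).colon (Ideal.span {φr' z' ^ ℓ} : Set R')).comap (Polynomial.eval₂RingHom φr' t₀') =
      ((K.comap (Polynomial.eval₂RingHom φr t₀)).map (substStep f z')).colon
        (Ideal.span {Polynomial.C (z' ^ ℓ)} : Set A'[X]) := by
  have hkt' : φk' t₀' = 0 := apply_generator_eq_zero φk' t₀' hker'
  have hsq : ∀ p, Polynomial.eval₂RingHom φr' t₀' (substStep f z' p) = β (Polynomial.eval₂RingHom φr t₀ p) :=
    fun p => by
      rw [← RingHom.comp_apply, eval₂RingHom_comp_substStep φr t₀ φr' t₀' f z' β hc1 hc2, RingHom.comp_apply]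
  have hψ'C : Polynomial.eval₂RingHom φr' t₀' (Polynomial.C (z' ^ ℓ)) = φr' z' ^ ℓ := by
    rw [Polynomial.coe_eval₂RingHom, Polynomial.eval₂_C, map_pow]
  have hCz : ∀ x : A'[X], Polynomial.C (z' ^ ℓ) * x = 0 → x = 0 := fun x hx => by
    ext n
    have := congrArg (fun y => y.coeff n) hx
    simp only [Polynomial.coeff_C_mul, Polynomial.coeff_zero] at this
    exact hz' ℓ _ this
  obtain ⟨q, c, hq, -, -⟩ := exists_quotient φr t₀ f z' hperm
  have hcolon : ((K.comap (Polynomial.eval₂RingHom φr t₀)).map (substStep f z')).colon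
      (Ideal.span {Polynomial.C (z' ^ ℓ)} : Set A'[X]) =
      Ideal.span (q '' (K.comap (Polynomial.eval₂RingHom φr t₀) : Set A[X])) :=
    colon_map_eq_span_of_forall z' (substStep f z') _ q hq hCz
  -- `𝔎·A′[t′] = (z′^ℓ) · span q`
  have hmapK : (K.comap (Polynomial.eval₂RingHom φr t₀)).map (substStep f z') =
      Ideal.span {Polynomial.C (z' ^ ℓ)} * Ideal.span (q '' (K.comap (Polynomial.eval₂RingHom φr t₀) : Set A[X])) := by
    apply le_antisymm
    · rw [Ideal.map_le_iff_le_comap]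
      intro p hp
      rw [Ideal.mem_comap, hq p hp]
      exact Ideal.mul_mem_mul (Ideal.mem_span_singleton_self _) (Ideal.subset_span ⟨p, hp, rfl⟩)
    · rw [Ideal.span_mul_span', Ideal.span_le, Set.singleton_mul]
      rintro _ ⟨_, ⟨p, hp, rfl⟩, rfl⟩
      change Polynomial.C (z' ^ ℓ) * q p ∈ _
      rw [← hq p hp]
      exact Ideal.mem_map_of_mem _ hp
  -- `t^ℓ ∈ span q` (the quotient of `t^ℓ` is `t′^ℓ`)
  have hXK : (X : A[X]) ^ ℓ ∈ K.comap (Polynomial.eval₂RingHom φr t₀) := by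
    rw [Ideal.mem_comap, map_pow, Polynomial.coe_eval₂RingHom, Polynomial.eval₂_X]; exact hK
  have hXq : (X : A'[X]) ^ ℓ ∈ Ideal.span (q '' (K.comap (Polynomial.eval₂RingHom φr t₀) : Set A[X])) := by
    have h1 := hq _ hXK
    rw [map_pow, substStep_X, mul_pow, ← map_pow] at h1
    have h2 : q (X ^ ℓ) = X ^ ℓ := by
      have : Polynomial.C (z' ^ ℓ) * (q (X ^ ℓ) - X ^ ℓ) = 0 := by rw [mul_sub, ← h1, sub_self]
      exact sub_eq_zero.mp (hCz _ this)
    rw [← h2]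
    exact Ideal.subset_span ⟨_, hXK, rfl⟩
  apply le_antisymm
  · -- `⊆`
    intro h hh
    rw [hcolon]
    rw [Ideal.mem_comap, Ideal.mem_colon_span_singleton, ← map_comap_eval₂RingHom_eq φk φr t₀ hkr hker hK, Ideal.map_map,
      ← eval₂RingHom_comp_substStep φr t₀ φr' t₀' f z' β hc1 hc2, ← Ideal.map_map, hmapK, Ideal.map_mul, Ideal.map_span,
      Set.image_singleton, hψ'C] at hh
    obtain ⟨y, hy, hyz⟩ := Ideal.mem_span_singleton_mul.mp hh
    have hψh : Polynomial.eval₂RingHom φr' t₀' h = y := by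
      have h0 : φr' z' ^ ℓ * (Polynomial.eval₂RingHom φr' t₀' h - y) = 0 := by
        rw [mul_sub, hyz, mul_comm, sub_self]
      exact sub_eq_zero.mp (hzR' _ h0)
    rw [← hψh] at hy
    obtain ⟨g, hg, u, hgu⟩ :=
      exists_eq_eval₂_add_pow_mul_of_mem_map_eval₂ φk' φr' t₀' hkr' hker' _ ℓ hy
    have hdvd : X ^ ℓ ∣ h - g :=
      X_pow_dvd_of_eval₂_mem_span_pow φk' φr' t₀' hkr' hkt' ht₀' ℓ (h - g)
        (by rw [map_sub, hgu, add_sub_cancel_left]; exact Ideal.mem_span_singleton'.mpr ⟨u, mul_comm _ _⟩)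
    obtain ⟨y', hy'⟩ := hdvd
    have hh' : h = g + X ^ ℓ * y' := by rw [← hy', add_sub_cancel]
    rw [hh']
    exact Submodule.add_mem _ hg (Ideal.mul_mem_right _ _ hXq)
  · -- `⊇`
    rw [hcolon, Ideal.span_le]
    rintro _ ⟨p, hp, rfl⟩
    rw [SetLike.mem_coe, Ideal.mem_comap, Ideal.mem_colon_span_singleton, ← hψ'C, ← map_mul, mul_comm, ← hq p hp, hsq]
    exact Ideal.mem_map_of_mem _ hp

include hkr hker hkr' hker' hc1 hc2 hK hperm hz' hzR' ht₀' in
/-- [OURS · L1 W5.2 · lead] **Coefficient ideals of the controlled transform (chart propagation)**: for `b < ℓ`,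
`coeffIdeal (ψ′⁻¹K′) b = Σ_{j ≤ b} (f(coeffIdeal (ψ⁻¹K) j)·A′ : z′^{ℓ−j})`. [cite: KawanoueMatsuki2016, §2 (transformation rule)] -/
theorem coeffIdeal_comap_controlledTransform {b : ℕ} (hb : b < ℓ) :
    coeffIdeal (((K.map β).colon (Ideal.span {φr' z' ^ ℓ} : Set R')).comap (Polynomial.eval₂RingHom φr' t₀')) b =
      ⨆ j ∈ Finset.range (b + 1),
        ((coeffIdeal (K.comap (Polynomial.eval₂RingHom φr t₀)) j).map f).colon (Ideal.span {z' ^ (ℓ - j)} : Set A') := by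
  have hCz : ∀ x : A'[X], Polynomial.C (z' ^ ℓ) * x = 0 → x = 0 := fun x hx => by
    ext n
    have := congrArg (fun y => y.coeff n) hx
    simp only [Polynomial.coeff_C_mul, Polynomial.coeff_zero] at this
    exact hz' ℓ _ this
  obtain ⟨q, c, hq, hqc, hc⟩ := exists_quotient φr t₀ f z' hperm
  rw [comap_controlledTransform_eq_colon φk φr t₀ hkr hker φk' φr' t₀' hkr' hker' f z' β hc1 hc2 hK hperm hz' hzR' ht₀',
    colon_map_eq_span_of_forall z' (substStep f z') _ q hq hCz, coeffIdeal_transform_eq f z' q c hqc hc hz' hb]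

include hkr hker hkr' hker' hc1 hc2 hK hperm hz' hzR' ht₀' in
/-- [OURS · L1 W5.2 · lead] **GLUE G3 — THE PROPAGATION LAW of the ring-level coefficient flag through a dictionary step**:
for `b < ℓ`, `coeffFlagRing φk′ φr′ b K′ = Σ_{j ≤ b} (f(coeffFlagRing φk φr j K)·A′ : z′^{ℓ−j})`, `K′ = (K·R′ : φr′(z′)^ℓ)` — the
Kawanoue–Matsuki transformation rule of the idealistic filtration `{(R_{ℓ−j}, ℓ−j)}`, level-mixing (all `j ≤ b` contribute).
[cite: KawanoueMatsuki2016, §2 (transformation rule)] -/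
theorem coeffFlagRing_controlledTransform {b : ℕ} (hb : b < ℓ) :
    coeffFlagRing φk' φr' b ((K.map β).colon (Ideal.span {φr' z' ^ ℓ} : Set R')) =
      ⨆ j ∈ Finset.range (b + 1),
        ((coeffFlagRing φk φr j K).map f).colon (Ideal.span {z' ^ (ℓ - j)} : Set A') := by
  rw [coeffFlagRing_eq_coeffIdeal_comap φk' φr' t₀' hkr' hker' (pow_mem_controlledTransform t₀ φr' t₀' z' β hc2 hK) b,
    coeffIdeal_comap_controlledTransform φk φr t₀ hkr hker φk' φr' t₀' hkr' hker' f z' β hc1 hc2 hK hperm hz' hzR' ht₀' hb]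
  refine iSup_congr fun j => iSup_congr fun _ => ?_
  rw [coeffFlagRing_eq_coeffIdeal_comap φk φr t₀ hkr hker hK j]

end Step

end DepthGraded.Taylor

end Summit.ResolutionOfSingularities.ResolutionOfSingularities.Theorems

end
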